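import Summits.Ventures.LatticeQCDFlow.Scoring.SU2TorusWilsonLoopSeries
import HarnessLib

/-!
# SU(2) on the 2-torus: THE EXACT FINITE-VOLUME WILSON LOOPS `⟨½ tr W_{R×T}⟩_{(ℤ/L)², β}`

HONEST FRAMING: exact (Metropolis-corrected) sampling algorithms for lattice gauge theory;
figures of merit are autocorrelation/cost numbers at stated couplings and volumes; no
continuum-physics claim.

Venture `LatticeQCDFlow` (cell pub-lqcd), sub-topic `Scoring`; FANOUT row 5 (`s0-sun-a`), GEN-11.
NEW WORK of the cell (placement rule); the lead's NOT-TYPED item 'Wilson loops larger than one plaquette'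
(oracle X02's `wilson_loops` `W_{1×1} … W_{4×4}`, RT-30 (146)) as a THEOREM about theory-2's Wilson measure
`wilsonMeasure (fundamentalRep (Fin 2)) β` on `(ℤ/L)²` (every `L ≥ 1`, `β ≥ 0`).  For a corner `(i,j)` and
`1 ≤ R ≤ L`, `1 ≤ T ≤ L`, `W_{R×T}` is the holonomy around the boundary of the lattice rectangle
`[i,i+R) × [j,j+T)` (`SU2TorusRectangleMerging`; a contractible `R × T` Wilson loop when `R, T ≤ L − 1`),
`c_n(β) = e^{−2β}(I_n(2β) − I_{n+2}(2β))` and `λ_n = c_n/(n+1)`.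

* **`wilson_mean_su2a0_loop_two`** — THE EXACT TORUS WILSON LOOP:
  `⟨½ tr W_{R×T}⟩_{(ℤ/L)²,β}
     = ½ Σ_n [λ_n^{RT}·(n+1)·λ_{n+1}^{L²−RT}/(n+2) + λ_{n+1}^{RT}·(n+2)·λ_n^{L²−RT}/(n+1)] / Σ_n λ_n^{L²}`
  — the area-`RT` disc glued to its genus-one complement along the loop,
  `Σ_{r,s} N_{r,½}^s (d_r/d_s) λ_r^{RT} λ_s^{L²−RT} / (2Z)`; for `RT = 1` it is
  `SU2TorusPlaquette.wilson_mean_su2a0_plaquette_two`, and as `L → ∞` the `n = 0` terms give the exact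
  area law `(λ_1/λ_0)^{RT} = (I₂(2β)/I₁(2β))^{RT}`.  Obtained WITHOUT Peter–Weyl and without gluing the
  complement: merge the rectangle, Clebsch–Gordan, un-merge, full-torus character integral.

Dictionary to the cell's tables (X02 / reference_table v0.3): `β_table = 2β`; float64 evaluation of the
typed series reproduces X02's SU(2) `wilson_loops` columns (e.g. `b = 2.2`, `L = 8`: `W_{1×2} =
0.2157407649`, `W_{2×2} = 0.0465440776`, `W_{3×3} = 0.0010062247`, `W_{4×4} = 4.693077e-6`).
Nothing is cited as a fact; no `def`.
-/

noncomputable section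

open Real MeasureTheory Set Function Finset Polynomial.Chebyshev
open Literature.MathematicalPhysics.QuantumFieldTheory Literature.MathematicalPhysics.QuantumLattice
open Literature.Analysis.FunctionSpaces
open Summit.Ventures.LatticeQCDFlow.Exactness
open Summit.Ventures.LatticeQCDFlow.Theory2.Lattice

namespace Summit.Ventures.LatticeQCDFlow.Scoring

variable {L : ℕ} [NeZero L]

/-! ## §4. The exact torus Wilson loop -/

/-- The dimension-normalised rewriting of one term: for `1 ≤ N ≤ V`,
`x^N y^{V−N} ((n+2)/(n+1))^{N−1} ((n+2)^V)⁻¹ = (x/(n+1))^N (n+1) (y/(n+2))^{V−N} (n+2)⁻¹`. -/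
theorem loop_term_normalised (x y : ℝ) (n : ℕ) {N V : ℕ} (hN : 1 ≤ N) (hNV : N ≤ V) :
    x ^ N * y ^ (V - N) * ((((n : ℝ) + 2) / ((n : ℝ) + 1)) ^ (N - 1)) * ((((n : ℝ) + 2) ^ V))⁻¹ =
      (x / ((n : ℝ) + 1)) ^ N * ((n : ℝ) + 1) * (y / ((n : ℝ) + 2)) ^ (V - N) / ((n : ℝ) + 2) := by
  obtain ⟨K, rfl⟩ : ∃ K, N = K + 1 := ⟨N - 1, by omega⟩
  obtain ⟨D, rfl⟩ : ∃ D, V = K + 1 + D := ⟨V - (K + 1), by omega⟩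
  rw [Nat.add_sub_cancel, Nat.add_sub_cancel_left]
  have h1 : ((n : ℝ) + 1) ≠ 0 := by positivity
  have h2 : ((n : ℝ) + 2) ≠ 0 := by positivity
  rw [div_pow, div_pow, div_pow]
  field_simp
  ring

/-- **THE EXACT SU(2) WILSON LOOPS ON THE 2-TORUS.**  For every `L ≥ 1`, `β ≥ 0`, corner `(i,j)` and
`1 ≤ R ≤ L`, `1 ≤ T ≤ L`, under theory-2's Wilson measure `wilsonMeasure (fundamentalRep (Fin 2)) β` on
`(ℤ/L)²`, the half-trace of the holonomy `W_{R×T}` around the boundary of the lattice rectangle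
`[i,i+R) × [j,j+T)` (a contractible `R × T` Wilson loop when `R, T ≤ L − 1`) has expectation
`⟨½ tr W_{R×T}⟩ = ½ Σ_n [λ_n^{RT}(n+1)·λ_{n+1}^{L²−RT}/(n+2) + λ_{n+1}^{RT}(n+2)·λ_n^{L²−RT}/(n+1)] / Σ_n λ_n^{L²}`,
`λ_n = c_n/(n+1)`, `c_n = e^{−2β}(I_n(2β) − I_{n+2}(2β))` — the 2-d gluing formula
`Σ_{r,s} N_{r,½}^s (d_r/d_s) λ_r^{A} λ_s^{V−A} / (2Z)` (area `A = RT`, volume `V = L²`), now a theorem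
about the Haar-based lattice measure; `RT = 1` is the exact plaquette, and the `n = 0` terms give the
infinite-volume area law `(I₂(2β)/I₁(2β))^{RT}`. -/
theorem wilson_mean_su2a0_loop_two {β : ℝ} (hβ : 0 ≤ β) (i j : ZMod L) {R T : ℕ} (hR : 1 ≤ R)
    (hRL : R ≤ L) (hT : 1 ≤ T) (hTL : T ≤ L) :
    ∫ V, su2a0 (((List.range R).map fun a : ℕ => V (![i + a, j], 0)).prod *
            ((List.range T).map fun b : ℕ => V (![i + R, j + b], 1)).prod *
            (((List.range R).map fun a : ℕ => V (![i + a, j + T], 0)).prod)⁻¹ *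
            (((List.range T).map fun b : ℕ => V (![i, j + b], 1)).prod)⁻¹)
        ∂(wilsonMeasure (d := 2) (L := L) (fundamentalRep (Fin 2)) β) =
      (∑' n : ℕ, (1 / 2) *
        ((Real.exp (-(2 * β)) * (besselI n (2 * β) - besselI (n + 2) (2 * β)) / ((n : ℝ) + 1)) ^ (R * T) *
            ((n : ℝ) + 1) *
            (Real.exp (-(2 * β)) * (besselI (n + 1) (2 * β) - besselI (n + 1 + 2) (2 * β)) / ((n : ℝ) + 2)) ^
              (L ^ 2 - R * T) / ((n : ℝ) + 2) +
          (Real.exp (-(2 * β)) * (besselI (n + 1) (2 * β) - besselI (n + 1 + 2) (2 * β)) / ((n : ℝ) + 2)) ^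
              (R * T) * ((n : ℝ) + 2) *
            (Real.exp (-(2 * β)) * (besselI n (2 * β) - besselI (n + 2) (2 * β)) / ((n : ℝ) + 1)) ^
              (L ^ 2 - R * T) / ((n : ℝ) + 1))) /
      ∑' n : ℕ, (Real.exp (-(2 * β)) * (besselI n (2 * β) - besselI (n + 2) (2 * β)) /
        ((n : ℝ) + 1)) ^ (L ^ 2) := by
  have hRT : 1 ≤ R * T := Nat.mul_pos hR hT
  have hRTV : R * T ≤ L ^ 2 := by rw [sq]; exact Nat.mul_le_mul hRL hTL
  rw [integral_wilsonMeasure_su2_eq_div,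
    ← (hasSum_integral_su2a0_loop_mul_exp_neg_wilsonAction_two hβ i j hR hRL hT hTL).tsum_eq,
    partitionFunction_su2_two_toReal_eq_tsum hβ]
  congr 1
  refine tsum_congr fun n => ?_
  rw [loop_term_normalised _ _ n hRT hRTV]
  -- the second term: the same identity with the roles of `n + 1` and `n + 2` exchanged
  obtain ⟨K, hK⟩ : ∃ K, R * T = K + 1 := ⟨R * T - 1, by omega⟩
  obtain ⟨D, hD⟩ : ∃ D, L ^ 2 = K + 1 + D := ⟨L ^ 2 - (K + 1), by omega⟩
  rw [hK, hD, Nat.add_sub_cancel, Nat.add_sub_cancel_left]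
  have h1 : ((n : ℝ) + 1) ≠ 0 := by positivity
  have h2 : ((n : ℝ) + 2) ≠ 0 := by positivity
  rw [div_pow, div_pow, div_pow, div_pow, div_pow]
  field_simp
  ring

end Summit.Ventures.LatticeQCDFlow.Scoring
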